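import Mathlib
import HarnessLib
import Summits.ValiantsHypothesis.ValiantsHypothesis.Theorems.LacunarySymmetroidMatrixDescartesOsculationLawPeelBranchArcCalculus

/-!
# ValiantsHypothesis / LacunarySymmetroid — crux `MatrixDescartes` (stmt-ValiantsHypothesis-18050, V1),
# line `Cruxes/MatrixDescartes/Lines/osculation_law.lean` («osculation-law»), stub `stub_peel` (all ranks `r`):
# THE BRANCH-ARC ENGINE

File 2/2.  `stub_peel` («a line meets a log-log-inflection-free arc of an eigenvalue branch at most twice»)
splits into (i) the existence and bookkeeping of the `r` real branches `b_j(t)` of `Φ(t, b) = det(G(t) + bP) = 0`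
(Rellich; zeros, escapes, osculation points) and (ii) the PER-ARC count.  This file proves (ii) for an ARBITRARY
polynomial `Φ ∈ ℝ[t, b]` and an arbitrary twice-differentiable branch:

* `card_roots_filter_branchArc_le_two` — let `β` be twice differentiable and positive on `(α, ω)` (`α ≥ 0`) with
  `Φ(t, β t) = 0`, `∂_bΦ(t, β t) ≠ 0` (smooth branch) and `H(Φ)(t, β t) ≠ 0` (no osculation point; `H` = the
  line's bordered log-Hessian, unfolded) for all `t ∈ (α, ω)`, and let `g(t) = Φ(t, c·t^N)`.  Then **the roots
  of `g` in `(α, ω)` that lie on the branch (`β t = c·t^N`), counted WITH multiplicity, number at most two.**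

Mechanism (Rolle twice, in the `t`-coordinate): between two meeting points `log β − N log t` has a critical
point, i.e. `tβ' = Nβ` (`exists_eulerDefect_eq_zero`); a meeting point of multiplicity `≥ 2` is itself such a
point (`eulerDefect_eq_zero_of_rootMultiplicity`, chain rule + the first-order branch identity); between two
points with `tβ' = Nβ` the function `tβ'/β` has a critical point, where `β β' + t β β'' − t β'² = 0`
(`exists_curv_eq_zero`), and a meeting point of multiplicity `≥ 3` is itself such a point
(`curv_eq_zero_of_rootMultiplicity`); by the key identity of file 1/2 (`logHessian_eval_eq`) that forces
`H(Φ) = 0` on the arc — an osculation point, excluded.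

Honest framing: the per-arc half of an OPEN stub; `stub_peel` (the branch bookkeeping (i) for `r ≥ 2` is not
here), the LAW `stub_osculationLaw`, `stub_recursion`, `MatrixDescartes`, Conjecture B and `VP ≠ VNP` are NOT
proved and nothing here is progress on them.  No definitions, no named facts; Mathlib only.
-/

-- `Summit.ValiantsHypothesis.ValiantsHypothesis.…` is the tree's mandated single-conjunct layout (Sub = Summit).
set_option linter.dupNamespace false

noncomputable section

namespace Summit.ValiantsHypothesis.ValiantsHypothesis.Theorems.LacunarySymmetroidMatrixDescartes

open Polynomial Set MvPolynomial
open scoped BigOperators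

namespace OsculationPeel

/-! ### Rolle, twice -/

/-- Between two points `x < y` of the arc at which the branch meets the monomial arc `b = c·t^N` there is a
point with `t·β'(t) = N·β(t)` (Rolle for `log β − N·log t`, which takes the value `log c` at both ends).
[folklore: Rolle] -/
theorem exists_eulerDefect_eq_zero {β β₁ : ℝ → ℝ} {c : ℝ} {N : ℕ} {α ω x y : ℝ} (hα : 0 ≤ α)
    (hβ : ∀ s ∈ Ioo α ω, HasDerivAt β (β₁ s) s) (hpos : ∀ s ∈ Ioo α ω, 0 < β s)
    (hx : α < x) (hy : y < ω) (hxy : x < y) (hbx : β x = c * x ^ N) (hby : β y = c * y ^ N) :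
    ∃ z ∈ Ioo x y, z * β₁ z - N * β z = 0 := by
  have hsub : ∀ s ∈ Icc x y, s ∈ Ioo α ω := fun s hs => ⟨lt_of_lt_of_le hx hs.1, lt_of_le_of_lt hs.2 hy⟩
  have hpos' : ∀ s ∈ Icc x y, 0 < s := fun s hs => lt_of_le_of_lt hα (lt_of_lt_of_le hx hs.1)
  have hx0 : 0 < x := lt_of_le_of_lt hα hx
  have hc : 0 < c := by
    have h := hpos x (hsub x (left_mem_Icc.2 hxy.le))
    rw [hbx] at h
    exact pos_of_mul_pos_left h (pow_nonneg hx0.le N)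
  have hD : ∀ s ∈ Icc x y, HasDerivAt (fun s => Real.log (β s) - N * Real.log s)
      (β₁ s / β s - N * s⁻¹) s := fun s hs =>
    ((hβ s (hsub s hs)).log (hpos s (hsub s hs)).ne').sub
      ((Real.hasDerivAt_log (hpos' s hs).ne').const_mul (N : ℝ))
  have hcont : ContinuousOn (fun s => Real.log (β s) - N * Real.log s) (Icc x y) :=
    fun s hs => (hD s hs).continuousAt.continuousWithinAt
  have hends : Real.log (β x) - N * Real.log x = Real.log (β y) - N * Real.log y := by
    rw [hbx, hby, Real.log_mul hc.ne' (pow_ne_zero N hx0.ne'), Real.log_pow,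
      Real.log_mul hc.ne' (pow_ne_zero N (hx0.trans hxy).ne'), Real.log_pow]
    ring
  obtain ⟨z, hz, hz0⟩ := exists_hasDerivAt_eq_zero hxy hcont hends (fun s hs => hD s (Ioo_subset_Icc_self hs))
  refine ⟨z, hz, ?_⟩
  have hz0' : 0 < z := hpos' z (Ioo_subset_Icc_self hz)
  have hβz : β z ≠ 0 := (hpos z (hsub z (Ioo_subset_Icc_self hz))).ne'
  have h := sub_eq_zero.1 hz0
  field_simp at h
  linear_combination h

/-- Between two points `u < v` of the arc with `t·β' = N·β` there is a point where
`β β' + t β β'' − t β'² = 0` (Rolle for `tβ'/β`). [folklore: Rolle] -/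
theorem exists_curv_eq_zero {β β₁ β₂ : ℝ → ℝ} {N : ℕ} {α ω u v : ℝ}
    (hβ : ∀ s ∈ Ioo α ω, HasDerivAt β (β₁ s) s) (hβ₁ : ∀ s ∈ Ioo α ω, HasDerivAt β₁ (β₂ s) s)
    (hpos : ∀ s ∈ Ioo α ω, 0 < β s) (hu : α < u) (hv : v < ω) (huv : u < v)
    (hmu : u * β₁ u - N * β u = 0) (hmv : v * β₁ v - N * β v = 0) :
    ∃ z ∈ Ioo u v, β z * β₁ z + z * β z * β₂ z - z * β₁ z ^ 2 = 0 := by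
  have hsub : ∀ s ∈ Icc u v, s ∈ Ioo α ω := fun s hs => ⟨lt_of_lt_of_le hu hs.1, lt_of_le_of_lt hs.2 hv⟩
  have hD : ∀ s ∈ Icc u v, HasDerivAt (fun s => s * β₁ s / β s)
      (((1 * β₁ s + s * β₂ s) * β s - s * β₁ s * β₁ s) / β s ^ 2) s := fun s hs =>
    (((hasDerivAt_id' s).mul (hβ₁ s (hsub s hs))).div (hβ s (hsub s hs)) (hpos s (hsub s hs)).ne')
  have hcont : ContinuousOn (fun s => s * β₁ s / β s) (Icc u v) :=
    fun s hs => (hD s hs).continuousAt.continuousWithinAt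
  have hβu : β u ≠ 0 := (hpos u (hsub u (left_mem_Icc.2 huv.le))).ne'
  have hβv : β v ≠ 0 := (hpos v (hsub v (right_mem_Icc.2 huv.le))).ne'
  have hends : u * β₁ u / β u = v * β₁ v / β v := by
    rw [div_eq_iff hβu, div_mul_eq_mul_div, eq_div_iff hβv]
    linear_combination β v * hmu - β u * hmv
  obtain ⟨z, hz, hz0⟩ := exists_hasDerivAt_eq_zero huv hcont hends (fun s hs => hD s (Ioo_subset_Icc_self hs))
  refine ⟨z, hz, ?_⟩
  have hβz : β z ≠ 0 := (hpos z (hsub z (Ioo_subset_Icc_self hz))).ne'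
  rw [div_eq_zero_iff, or_iff_left (pow_ne_zero 2 hβz)] at hz0
  linear_combination hz0

/-! ### Meeting points of multiplicity `≥ 2` and `≥ 3` -/

/-- The value of `g' = d/dt Φ(t, c t^N)`. [folklore] -/
theorem eval_derivative_eq (Φ : MvPolynomial (Fin 2) ℝ) (g : ℝ[X]) (c : ℝ) (N : ℕ)
    (hg : ∀ t, g.eval t = MvPolynomial.eval ![t, c * t ^ N] Φ) (x : ℝ) :
    (derivative g).eval x = MvPolynomial.eval ![x, c * x ^ N] (pderiv 0 Φ)
      + MvPolynomial.eval ![x, c * x ^ N] (pderiv 1 Φ) * (c * (N * x ^ (N - 1))) := by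
  have h1 : HasDerivAt (fun s => g.eval s) ((derivative g).eval x) x := Polynomial.hasDerivAt g x
  rw [show (fun s => g.eval s) = fun s => MvPolynomial.eval ![s, c * s ^ N] Φ from funext hg] at h1
  have h2 := hasDerivAt_mvPolynomial_eval Φ (hasDerivAt_id' x) ((hasDerivAt_pow N x).const_mul c)
  have := h1.unique h2
  rw [this]
  ring

/-- The value of `g''`. [folklore] -/
theorem eval_derivative_derivative_eq (Φ : MvPolynomial (Fin 2) ℝ) (g : ℝ[X]) (c : ℝ) (N : ℕ)
    (hg : ∀ t, g.eval t = MvPolynomial.eval ![t, c * t ^ N] Φ) (x : ℝ) :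
    (derivative (derivative g)).eval x =
      MvPolynomial.eval ![x, c * x ^ N] (pderiv 0 (pderiv 0 Φ))
        + MvPolynomial.eval ![x, c * x ^ N] (pderiv 1 (pderiv 0 Φ)) * (c * (N * x ^ (N - 1)))
        + ((MvPolynomial.eval ![x, c * x ^ N] (pderiv 0 (pderiv 1 Φ))
            + MvPolynomial.eval ![x, c * x ^ N] (pderiv 1 (pderiv 1 Φ)) * (c * (N * x ^ (N - 1))))
              * (c * (N * x ^ (N - 1)))
          + MvPolynomial.eval ![x, c * x ^ N] (pderiv 1 Φ) * (c * (N * (((N - 1 : ℕ) : ℝ) * x ^ (N - 1 - 1))))) := by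
  have h1 : HasDerivAt (fun s => (derivative g).eval s) ((derivative (derivative g)).eval x) x :=
    Polynomial.hasDerivAt (derivative g) x
  have hfun : (fun s => (derivative g).eval s) = fun s =>
      MvPolynomial.eval ![s, c * s ^ N] (pderiv 0 Φ)
        + MvPolynomial.eval ![s, c * s ^ N] (pderiv 1 Φ) * (c * (N * s ^ (N - 1))) :=
    funext (eval_derivative_eq Φ g c N hg)
  rw [hfun] at h1
  have hγ : HasDerivAt (fun s : ℝ => c * s ^ N) (c * (N * x ^ (N - 1))) x := (hasDerivAt_pow N x).const_mul c
  have hγ₁ : HasDerivAt (fun s : ℝ => c * (N * s ^ (N - 1))) (c * (N * (((N - 1 : ℕ) : ℝ) * x ^ (N - 1 - 1)))) x :=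
    ((hasDerivAt_pow (N - 1) x).const_mul (N : ℝ)).const_mul c
  have hA := hasDerivAt_mvPolynomial_eval (pderiv 0 Φ) (hasDerivAt_id' x) hγ
  have hB := (hasDerivAt_mvPolynomial_eval (pderiv 1 Φ) (hasDerivAt_id' x) hγ).mul hγ₁
  have h2 := hA.add hB
  have := h1.unique h2
  rw [this]
  ring

/-- **A meeting point of multiplicity `≥ 2` has `t·β' = N·β`** (the branch is tangent to the monomial arc
there: chain rule for `g` and the first-order branch identity, `∂_bΦ ≠ 0`). [folklore] -/
theorem deriv_eq_of_rootMultiplicity (Φ : MvPolynomial (Fin 2) ℝ) (g : ℝ[X]) (c : ℝ) (N : ℕ)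
    {β β₁ : ℝ → ℝ} {α ω x : ℝ} (hg : ∀ t, g.eval t = MvPolynomial.eval ![t, c * t ^ N] Φ)
    (hβ : ∀ s ∈ Ioo α ω, HasDerivAt β (β₁ s) s) (hΦ : ∀ s ∈ Ioo α ω, MvPolynomial.eval ![s, β s] Φ = 0)
    (hx : x ∈ Ioo α ω) (hΦb : MvPolynomial.eval ![x, β x] (pderiv 1 Φ) ≠ 0) (hbx : β x = c * x ^ N)
    (h2 : 1 < g.rootMultiplicity x) : β₁ x = c * (N * x ^ (N - 1)) := by
  have h1 : (derivative g).IsRoot x := by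
    have := rootMultiplicity_sub_one_le_derivative_rootMultiplicity g x
    exact ((rootMultiplicity_pos') |>.1 (by omega)).2
  have hd := eval_derivative_eq Φ g c N hg x
  rw [h1.eq_zero, ← hbx] at hd
  have hfirst := branch_first_order Φ hβ hΦ hx
  have : MvPolynomial.eval ![x, β x] (pderiv 1 Φ) * (β₁ x - c * (N * x ^ (N - 1))) = 0 := by
    linear_combination hfirst + hd
  rcases mul_eq_zero.1 this with h | h
  · exact absurd h hΦb
  · linarith

/-- In the form `t·β'(t) − N·β(t) = 0`. [folklore] -/
theorem eulerDefect_eq_zero_of_rootMultiplicity (Φ : MvPolynomial (Fin 2) ℝ) (g : ℝ[X]) (c : ℝ) (N : ℕ)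
    {β β₁ : ℝ → ℝ} {α ω x : ℝ} (hg : ∀ t, g.eval t = MvPolynomial.eval ![t, c * t ^ N] Φ)
    (hβ : ∀ s ∈ Ioo α ω, HasDerivAt β (β₁ s) s) (hΦ : ∀ s ∈ Ioo α ω, MvPolynomial.eval ![s, β s] Φ = 0)
    (hx : x ∈ Ioo α ω) (hΦb : MvPolynomial.eval ![x, β x] (pderiv 1 Φ) ≠ 0) (hbx : β x = c * x ^ N)
    (h2 : 1 < g.rootMultiplicity x) : x * β₁ x - N * β x = 0 := by
  rw [deriv_eq_of_rootMultiplicity Φ g c N hg hβ hΦ hx hΦb hbx h2, hbx]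
  rcases Nat.eq_zero_or_pos N with hN | hN
  · subst hN; simp
  · have hxN : x * x ^ (N - 1) = x ^ N := by
      rw [← pow_succ']; congr 1; omega
    linear_combination c * N * hxN

/-- **A meeting point of multiplicity `≥ 3` has zero log-log curvature**: `β β' + t β β'' − t β'² = 0` there
(the branch osculates the monomial arc to second order). [folklore] -/
theorem curv_eq_zero_of_rootMultiplicity (Φ : MvPolynomial (Fin 2) ℝ) (g : ℝ[X]) (c : ℝ) (N : ℕ)
    {β β₁ β₂ : ℝ → ℝ} {α ω x : ℝ} (hg : ∀ t, g.eval t = MvPolynomial.eval ![t, c * t ^ N] Φ)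
    (hβ : ∀ s ∈ Ioo α ω, HasDerivAt β (β₁ s) s) (hβ₁ : ∀ s ∈ Ioo α ω, HasDerivAt β₁ (β₂ s) s)
    (hΦ : ∀ s ∈ Ioo α ω, MvPolynomial.eval ![s, β s] Φ = 0)
    (hx : x ∈ Ioo α ω) (hΦb : MvPolynomial.eval ![x, β x] (pderiv 1 Φ) ≠ 0) (hbx : β x = c * x ^ N)
    (h3 : 2 < g.rootMultiplicity x) : β x * β₁ x + x * β x * β₂ x - x * β₁ x ^ 2 = 0 := by
  have hβ₁x := deriv_eq_of_rootMultiplicity Φ g c N hg hβ hΦ hx hΦb hbx (by omega)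
  -- `g''(x) = 0`
  have h2root : (derivative (derivative g)).IsRoot x := by
    have hd1 := rootMultiplicity_sub_one_le_derivative_rootMultiplicity g x
    have hd2 := rootMultiplicity_sub_one_le_derivative_rootMultiplicity (derivative g) x
    exact ((rootMultiplicity_pos') |>.1 (by omega)).2
  have hdd := eval_derivative_derivative_eq Φ g c N hg x
  rw [h2root.eq_zero, ← hbx, ← hβ₁x] at hdd
  have hsecond := branch_second_order Φ hβ hβ₁ hΦ hx
  -- hence `β''(x)` is the second derivative of the monomial arc
  have hβ₂x : MvPolynomial.eval ![x, β x] (pderiv 1 Φ) *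
      (β₂ x - c * (N * (((N - 1 : ℕ) : ℝ) * x ^ (N - 1 - 1)))) = 0 := by
    linear_combination hsecond + hdd
  rcases mul_eq_zero.1 hβ₂x with h | h
  · exact absurd h hΦb
  have hβ₂ : β₂ x = c * (N * (((N - 1 : ℕ) : ℝ) * x ^ (N - 1 - 1))) := by linarith
  rw [hβ₂, hβ₁x, hbx]
  rcases Nat.lt_or_ge N 2 with hN | hN
  · interval_cases N
    · simp
    · simp; ring
  · obtain ⟨M, rfl⟩ : ∃ M, N = M + 2 := ⟨N - 2, by omega⟩
    simp only [Nat.add_sub_cancel, show M + 2 - 1 = M + 1 from rfl, Nat.cast_add, Nat.cast_ofNat, Nat.cast_one,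
      pow_succ]
    ring

/-! ### The engine -/

/-- **Branch-arc engine** (the per-arc half of `stub_peel`, every rank).  Let `β` be twice differentiable and
positive on `(α, ω)`, `α ≥ 0`, with `Φ(t, β t) = 0`, `∂_bΦ(t, β t) ≠ 0` and `H(Φ)(t, β t) ≠ 0` there (`H` = the
line's bordered log-Hessian, unfolded), and let `g(t) = Φ(t, c·t^N)`.  Then the roots of `g` in `(α, ω)` lying
on the branch, counted with multiplicity, number at most two. [folklore] -/
theorem card_roots_filter_branchArc_le_two (Φ : MvPolynomial (Fin 2) ℝ) (g : ℝ[X]) (c : ℝ) (N : ℕ)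
    {α ω : ℝ} (hα : 0 ≤ α) (β β₁ β₂ : ℝ → ℝ)
    (hg : ∀ t, g.eval t = MvPolynomial.eval ![t, c * t ^ N] Φ)
    (hβ : ∀ s ∈ Ioo α ω, HasDerivAt β (β₁ s) s) (hβ₁ : ∀ s ∈ Ioo α ω, HasDerivAt β₁ (β₂ s) s)
    (hpos : ∀ s ∈ Ioo α ω, 0 < β s) (hΦ : ∀ s ∈ Ioo α ω, MvPolynomial.eval ![s, β s] Φ = 0)
    (hΦb : ∀ s ∈ Ioo α ω, MvPolynomial.eval ![s, β s] (pderiv 1 Φ) ≠ 0)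
    (hH : ∀ s ∈ Ioo α ω, MvPolynomial.eval ![s, β s]
        (X 0 * pderiv 0 (X 0 * pderiv 0 Φ) * (X 1 * pderiv 1 Φ) ^ 2
          - 2 * (X 0 * pderiv 0 (X 1 * pderiv 1 Φ)) * (X 0 * pderiv 0 Φ) * (X 1 * pderiv 1 Φ)
          + X 1 * pderiv 1 (X 1 * pderiv 1 Φ) * (X 0 * pderiv 0 Φ) ^ 2) ≠ 0) :
    Multiset.card (g.roots.filter (fun t => α < t ∧ t < ω ∧ β t = c * t ^ N)) ≤ 2 := by
  classical
  by_cases hg0 : g = 0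
  · simp [hg0]
  -- the curvature numerator never vanishes on the arc
  have hcurv : ∀ s ∈ Ioo α ω, β s * β₁ s + s * β s * β₂ s - s * β₁ s ^ 2 ≠ 0 := by
    intro s hs h0
    apply hH s hs
    rw [logHessian_eval_eq Φ s (β s) (β₁ s) (β₂ s) (branch_first_order Φ hβ hΦ hs)
      (branch_second_order Φ hβ hβ₁ hΦ hs), h0]
    ring
  set M := g.roots.filter (fun t => α < t ∧ t < ω ∧ β t = c * t ^ N) with hM
  set D := M.toFinset with hD
  have memD : ∀ x ∈ D, (α < x ∧ x < ω ∧ β x = c * x ^ N) ∧ g.IsRoot x := by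
    intro x hx
    rw [hD, Multiset.mem_toFinset, hM, Multiset.mem_filter, mem_roots hg0] at hx
    exact ⟨hx.2, hx.1⟩
  have countD : ∀ x ∈ D, M.count x = g.rootMultiplicity x := by
    intro x hx
    rw [hM, Multiset.count_filter_of_pos (p := fun t => α < t ∧ t < ω ∧ β t = c * t ^ N) (memD x hx).1,
      count_roots]
  -- H1: between two meeting points, a point with `tβ' = Nβ`
  have H1 : ∀ x y, x ∈ D → y ∈ D → x < y → ∃ z ∈ Ioo x y, z * β₁ z - N * β z = 0 := by
    intro x y hx hy hxy
    obtain ⟨⟨hxα, -, hbx⟩, -⟩ := memD x hx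
    obtain ⟨⟨-, hyω, hby⟩, -⟩ := memD y hy
    exact exists_eulerDefect_eq_zero hα hβ hpos hxα hyω hxy hbx hby
  -- H2: two points with `tβ' = Nβ` in the arc are impossible
  have H2 : ∀ u v, α < u → v < ω → u < v → u * β₁ u - N * β u = 0 → v * β₁ v - N * β v = 0 → False := by
    intro u v hu hv huv hmu hmv
    obtain ⟨z, hz, hz0⟩ := exists_curv_eq_zero (N := N) hβ hβ₁ hpos hu hv huv hmu hmv
    exact hcurv z ⟨hu.trans hz.1, hz.2.trans hv⟩ hz0
  -- the count
  by_contra hcard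
  push Not at hcard
  have hsum : Multiset.card M = ∑ x ∈ D, M.count x := (Multiset.toFinset_sum_count_eq M).symm
  by_cases h3 : ∃ x ∈ D, 3 ≤ M.count x
  · obtain ⟨x, hx, h3x⟩ := h3
    rw [countD x hx] at h3x
    obtain ⟨⟨hxα, hxω, hbx⟩, -⟩ := memD x hx
    exact hcurv x ⟨hxα, hxω⟩ (curv_eq_zero_of_rootMultiplicity Φ g c N hg hβ hβ₁ hΦ ⟨hxα, hxω⟩
      (hΦb x ⟨hxα, hxω⟩) hbx (by omega))
  push Not at h3
  by_cases h2 : ∃ x ∈ D, M.count x = 2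
  · obtain ⟨x, hx, h2x⟩ := h2
    obtain ⟨⟨hxα, hxω, hbx⟩, -⟩ := memD x hx
    have hmx : x * β₁ x - N * β x = 0 := by
      rw [countD x hx] at h2x
      exact eulerDefect_eq_zero_of_rootMultiplicity Φ g c N hg hβ hΦ ⟨hxα, hxω⟩ (hΦb x ⟨hxα, hxω⟩) hbx
        (by omega)
    have hy : ∃ y ∈ D, y ≠ x := by
      by_contra hno
      push Not at hno
      have hDx : D = {x} := Finset.eq_singleton_iff_unique_mem.2 ⟨hx, hno⟩
      rw [hsum, hDx, Finset.sum_singleton, h2x] at hcard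
      omega
    obtain ⟨y, hy, hyx⟩ := hy
    obtain ⟨⟨hyα, hyω, -⟩, -⟩ := memD y hy
    rcases lt_or_gt_of_ne hyx with hlt | hlt
    · obtain ⟨z, hz, hmz⟩ := H1 y x hy hx hlt
      exact H2 z x (hyα.trans hz.1) hxω hz.2 hmz hmx
    · obtain ⟨z, hz, hmz⟩ := H1 x y hx hy hlt
      exact H2 x z hxα (hz.2.trans hyω) hz.1 hmx hmz
  push Not at h2
  have hle1 : ∀ x ∈ D, M.count x ≤ 1 := by
    intro x hx
    have := h3 x hx
    have := h2 x hx
    omega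
  have hDcard : 3 ≤ D.card := by
    have : Multiset.card M ≤ ∑ x ∈ D, 1 := hsum ▸ Finset.sum_le_sum hle1
    simp only [Finset.sum_const, smul_eq_mul, mul_one] at this
    omega
  have hDne : D.Nonempty := Finset.card_pos.1 (by omega)
  set x₁ := D.min' hDne with hx₁
  set x₃ := D.max' hDne with hx₃
  have hx₁D : x₁ ∈ D := Finset.min'_mem D hDne
  have hx₃D : x₃ ∈ D := Finset.max'_mem D hDne
  have hD' : ((D.erase x₁).erase x₃).Nonempty := by
    apply Finset.card_pos.1
    have h1 := Finset.pred_card_le_card_erase (s := D) (a := x₁)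
    have h2 := Finset.pred_card_le_card_erase (s := D.erase x₁) (a := x₃)
    omega
  obtain ⟨x₂, hx₂⟩ := hD'
  have hx₂3 : x₂ ≠ x₃ := Finset.ne_of_mem_erase hx₂
  have hx₂' : x₂ ∈ D.erase x₁ := Finset.mem_of_mem_erase hx₂
  have hx₂1 : x₂ ≠ x₁ := Finset.ne_of_mem_erase hx₂'
  have hx₂D : x₂ ∈ D := Finset.mem_of_mem_erase hx₂'
  have h12 : x₁ < x₂ := lt_of_le_of_ne (Finset.min'_le D x₂ hx₂D) (Ne.symm hx₂1)
  have h23 : x₂ < x₃ := lt_of_le_of_ne (Finset.le_max' D x₂ hx₂D) hx₂3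
  obtain ⟨z₁, hz₁, hm₁⟩ := H1 x₁ x₂ hx₁D hx₂D h12
  obtain ⟨z₂, hz₂, hm₂⟩ := H1 x₂ x₃ hx₂D hx₃D h23
  obtain ⟨⟨h1α, -, -⟩, -⟩ := memD x₁ hx₁D
  obtain ⟨⟨-, h3ω, -⟩, -⟩ := memD x₃ hx₃D
  exact H2 z₁ z₂ (h1α.trans hz₁.1) (hz₂.2.trans h3ω) (hz₁.2.trans hz₂.1) hm₁ hm₂

end OsculationPeel

end Summit.ValiantsHypothesis.ValiantsHypothesis.Theorems.LacunarySymmetroidMatrixDescartes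

end
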